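/-
Copyright (c) 2026. All rights reserved.
Released under Apache 2.0 license as described in the file LICENSE.
Authors: abc-iut cell — seat abc-iut-L4-t8 (wave 2, L4 discharge; consumes abc-iut-L4-t14's
`HolomorphicCoresDeckProofs`).
-/
import Literature.AnabelianGeometry.AbsoluteAnabelian.RCHolomorphicCalculus
import Literature.AnabelianGeometry.AbsoluteAnabelian.HolomorphicCoresDeckProofs
import HarnessLib

/-!
# Inverses of RC-holomorphic homeomorphisms of Riemann surfaces ([AbsTopIII] Def 2.1 (ii))

PROOF-ONLY continuation of `RCHolomorphicCalculus.lean`: for a homeomorphism `φ : X ≃ₜ Y` of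
Riemann surfaces, UNCONDITIONALLY (no hypothesis on `φ⁻¹`),

* `IsHolAt.symm_apply` — if `φ` is holomorphic at `p` then `φ⁻¹` is holomorphic at `φ p` (restrict
  `φ` to an open neighbourhood where it is holomorphic and apply the holomorphic inverse-function
  theorem for open partial homeomorphisms of Riemann surfaces, abc-iut-L4-t14's
  `mdifferentiableAt_symm_of_mdifferentiable`, Fritzsche–Grauert I.8.6 as proved in the tree);
* `IsAntiHolAt.symm_apply` — if `φ` is anti-holomorphic at `p` then `φ⁻¹` is anti-holomorphic at
  `φ p` (the same after composing a chart with `conj`, using chart-independence of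
  anti-holomorphy);
* `IsRCHolomorphic.symm_homeomorph` — the inverse of an RC-holomorphic homeomorphism is
  RC-holomorphic.

(abc-iut-L4-t7's `isHolAt_symm_of_isHolAt` / `isAntiHolAt_symm_of_isAntiHolAt` in
`AutHolomorphicSpacesHolTypeProofs` assume RC-holomorphy of the inverse; these do not.)  Refereed
pre-IUT material; nothing here bears on the disputed [IUTchIII] Cor. 3.12; no side taken.
-/

noncomputable section

namespace Literature.AnabelianGeometry.AbsoluteAnabelian

universe u

open _root_.TopologicalSpace _root_.Topology _root_.Set _root_.Metric _root_.Function _root_.Filter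
open scoped _root_.Manifold _root_.ContDiff ComplexConjugate

section Inverse

variable {X Y : Type u} [TopologicalSpace X] [ChartedSpace ℂ X] [IsManifold 𝓘(ℂ, ℂ) ω X]
  [TopologicalSpace Y] [ChartedSpace ℂ Y] [IsManifold 𝓘(ℂ, ℂ) ω Y]

/-! ### Inverses of homeomorphisms -/

/-- **The inverse of a homeomorphism holomorphic at `p` is holomorphic at `φ p`** — unconditionally
(no hypothesis on `φ⁻¹`): restrict `φ` to an open neighbourhood where it is holomorphic and apply
the holomorphic inverse-function theorem for open partial homeomorphisms of Riemann surfaces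
(`mdifferentiableAt_symm_of_mdifferentiable`).
[cite: MochizukiAbsTopIII2015, Definition 2.1 (ii) p.51] -/
theorem IsHolAt.symm_apply (φ : X ≃ₜ Y) {p : X} (h : IsHolAt (⇑φ) p) : IsHolAt (⇑φ.symm) (φ p) := by
  obtain ⟨N, hNsub, hNo, hpN⟩ := mem_nhds_iff.1 h
  set e := φ.toOpenPartialHomeomorph.restrOpen N hNo with he
  have hsrc : e.source = N := by
    rw [he, OpenPartialHomeomorph.restrOpen_source]
    simp
  have hd : ∀ u ∈ e.source, MDifferentiableAt 𝓘(ℂ, ℂ) 𝓘(ℂ, ℂ) e u := by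
    intro u hu
    rw [hsrc] at hu
    exact hNsub hu
  have hpe : p ∈ e.source := by rw [hsrc]; exact hpN
  have htgt : e.target ∈ 𝓝 (φ p) := e.open_target.mem_nhds (e.map_source hpe)
  filter_upwards [htgt] with y hy
  exact mdifferentiableAt_symm_of_mdifferentiable e hd hy

/-- **The inverse of a homeomorphism anti-holomorphic at `p` is anti-holomorphic at `φ p`** —
unconditionally: in charts `a` at `x' = φ⁻¹ y'` and `b` at `y'`, `conj ∘ b ∘ φ ∘ a⁻¹` is an
injective holomorphic map near `a x'` (chart-independence of anti-holomorphy), hence an open partial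
homeomorphism of `ℂ` with holomorphic inverse `a ∘ φ⁻¹ ∘ b⁻¹ ∘ conj` (Fritzsche–Grauert I.8.6 as
in the tree), i.e. `conj ∘ (a ∘ φ⁻¹ ∘ b⁻¹)` is `ℂ`-differentiable at `b y'`.
[cite: MochizukiAbsTopIII2015, Definition 2.1 (ii) p.51] -/
theorem IsAntiHolAt.symm_apply (φ : X ≃ₜ Y) {p : X} (h : IsAntiHolAt (⇑φ) p) :
    IsAntiHolAt (⇑φ.symm) (φ p) := by
  have hA : ∀ᶠ x' in 𝓝 p, ∀ᶠ x'' in 𝓝 x', ∀ (a : OpenPartialHomeomorph X ℂ)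
      (b : OpenPartialHomeomorph Y ℂ), a ∈ atlas ℂ X → b ∈ atlas ℂ Y → x'' ∈ a.source →
      φ x'' ∈ b.source → DifferentiableAt ℂ (conj ∘ (b ∘ φ ∘ a.symm)) (a x'') :=
    h.eventually_differentiableAt_conj_charts.eventually_nhds
  have hc : Tendsto φ.symm (𝓝 (φ p)) (𝓝 p) := by
    have := φ.symm.continuous.continuousAt (x := φ p)
    rwa [ContinuousAt, φ.symm_apply_apply] at this
  filter_upwards [hc.eventually hA] with y' hy'
  set x' := φ.symm y' with hx'def
  have hφx' : φ x' = y' := by rw [hx'def, φ.apply_symm_apply]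
  set a := chartAt ℂ x' with ha
  set b := chartAt ℂ y' with hb
  refine ⟨φ.symm.continuous.continuousAt, ?_⟩
  -- `conj ∘ (b ∘ φ ∘ a⁻¹)` is differentiable near `a x'`
  have hT : ∀ᶠ x'' in 𝓝 x', DifferentiableAt ℂ (conj ∘ (b ∘ φ ∘ a.symm)) (a x'') := by
    have hbs : ∀ᶠ x'' in 𝓝 x', φ x'' ∈ b.source := by
      refine φ.continuous.continuousAt.preimage_mem_nhds (b.open_source.mem_nhds ?_)
      rw [hφx']; exact mem_chart_source ℂ y'
    filter_upwards [hy', a.open_source.mem_nhds (mem_chart_source ℂ x'), hbs] with x'' h1 h2 h3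
    exact h1 a b (chart_mem_atlas ℂ x') (chart_mem_atlas ℂ y') h2 h3
  have hO : ∀ᶠ z in 𝓝 (a x'), DifferentiableAt ℂ (conj ∘ (b ∘ φ ∘ a.symm)) z := by
    have := (a.eventually_nhds' (fun x'' => DifferentiableAt ℂ (conj ∘ (b ∘ φ ∘ a.symm)) (a x''))
      (mem_chart_source ℂ x')).2 hT
    filter_upwards [this, a.eventually_right_inverse' (mem_chart_source ℂ x')] with z hz hri
    rwa [hri] at hz
  -- an open ball `B` around `a x'` inside the domain where everything is defined and differentiable
  have hsrc : ∀ᶠ z in 𝓝 (a x'), z ∈ a.target ∧ φ (a.symm z) ∈ b.source := by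
    have h1 : ∀ᶠ z in 𝓝 (a x'), z ∈ a.target :=
      a.open_target.mem_nhds (a.map_source (mem_chart_source ℂ x'))
    have h2 : ∀ᶠ z in 𝓝 (a x'), φ (a.symm z) ∈ b.source := by
      have hc' : ContinuousAt (φ ∘ a.symm) (a x') :=
        φ.continuous.continuousAt.comp (a.continuousAt_symm (a.map_source (mem_chart_source ℂ x')))
      refine hc'.preimage_mem_nhds (b.open_source.mem_nhds ?_)
      rw [comp_apply, a.left_inv (mem_chart_source ℂ x'), hφx']
      exact mem_chart_source ℂ y'
    exact h1.and h2
  obtain ⟨r, hr, hball⟩ := Metric.eventually_nhds_iff_ball.1 (hO.and hsrc)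
  -- the open partial homeomorphism `G = conj ∘ b ∘ φ ∘ a⁻¹` on the ball
  set conjH : OpenPartialHomeomorph ℂ ℂ :=
    (Complex.conjCLE : ℂ ≃L[ℝ] ℂ).toHomeomorph.toOpenPartialHomeomorph with hconjH
  set G₀ : OpenPartialHomeomorph ℂ ℂ :=
    ((a.symm.trans φ.toOpenPartialHomeomorph).trans b).trans conjH with hG₀
  set G : OpenPartialHomeomorph ℂ ℂ := G₀.restrOpen (ball (a x') r) isOpen_ball with hG
  have hGfun : ∀ z, G z = conj (b (φ (a.symm z))) := fun z => by
    simp [hG, hG₀, hconjH]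
  have hGsymm : ∀ w, G.symm w = a (φ.symm (b.symm (conj w))) := fun w => by
    simp [hG, hG₀, hconjH, Complex.conjCLE]
    rfl
  have hGsource : ∀ z, z ∈ ball (a x') r → z ∈ a.target → φ (a.symm z) ∈ b.source →
      z ∈ G.source := by
    intro z hz1 hz2 hz3
    rw [hG, OpenPartialHomeomorph.restrOpen_source]
    refine ⟨?_, hz1⟩
    simp [hG₀, hconjH, hz2, hz3]
  have hGsource' : ∀ z ∈ G.source, z ∈ ball (a x') r := by
    intro z hz
    rw [hG, OpenPartialHomeomorph.restrOpen_source] at hz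
    exact hz.2
  -- `G` is holomorphic on its source
  have hGd : DifferentiableOn ℂ G G.source := by
    intro z hz
    have hz' := hGsource' z hz
    have hfun : (G : ℂ → ℂ) = conj ∘ (b ∘ φ ∘ a.symm) := funext fun z => by
      rw [hGfun]; rfl
    rw [hfun]
    exact ((hball z hz').1).differentiableWithinAt
  -- hence `G⁻¹` is holomorphic on the target (Fritzsche–Grauert I.8.6)
  have hGsymm_d : DifferentiableOn ℂ G.symm G.target :=
    Literature.Analysis.Complex.SCV.differentiableOn_symm_of_differentiableOn rfl G hGd
  -- the point `conj (b y')` lies in the target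
  have hz₀ : a x' ∈ G.source :=
    hGsource _ (mem_ball_self hr) (a.map_source (mem_chart_source ℂ x'))
      (by rw [a.left_inv (mem_chart_source ℂ x'), hφx']; exact mem_chart_source ℂ y')
  have hw₀ : G (a x') = conj (b y') := by
    rw [hGfun, a.left_inv (mem_chart_source ℂ x'), hφx']
  have hw₀T : conj (b y') ∈ G.target := by rw [← hw₀]; exact G.map_source hz₀
  have hdiffAt : DifferentiableAt ℂ G.symm (conj (b y')) :=
    (hGsymm_d _ hw₀T).differentiableAt (G.open_target.mem_nhds hw₀T)
  -- read off: `conj ∘ W_{y'} φ⁻¹ = conj ∘ G⁻¹ ∘ conj`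
  have hW : (conj ∘ writtenInExtChartAt 𝓘(ℂ, ℂ) 𝓘(ℂ, ℂ) y' (⇑φ.symm)) = (conj ∘ G.symm ∘ conj) := by
    funext w
    simp only [comp_apply, hGsymm, Complex.conj_conj, writtenInExtChartAt_apply_eq, ← ha, ← hb,
      ← hx'def]
  have hpt : extChartAt 𝓘(ℂ, ℂ) y' y' = conj (conj (b y')) := by
    rw [Complex.conj_conj, extChartAt_apply_eq]
  rw [hW, hpt]
  exact hdiffAt.conj_conj

/-- **The inverse of an RC-holomorphic homeomorphism of Riemann surfaces is RC-holomorphic.**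
[cite: MochizukiAbsTopIII2015, Definition 2.1 (ii) p.51] -/
theorem IsRCHolomorphic.symm_homeomorph (φ : X ≃ₜ Y) (h : IsRCHolomorphic (⇑φ)) :
    IsRCHolomorphic (⇑φ.symm) := by
  intro y
  rcases h (φ.symm y) with hh | hh
  · left
    have := hh.symm_apply φ
    rwa [φ.apply_symm_apply] at this
  · right
    have := hh.symm_apply φ
    rwa [φ.apply_symm_apply] at this

end Inverse

end Literature.AnabelianGeometry.AbsoluteAnabelian
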